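import Mathlib
import Summits.ValiantsHypothesis.ValiantsHypothesis.Theorems.NewtonUnitEquationsDissociatedUniformTotalsLaw
import Summits.ValiantsHypothesis.ValiantsHypothesis.Theorems.NewtonUnitEquationsDissociatedUniformTotalsLawUnion
import Summits.ValiantsHypothesis.ValiantsHypothesis.Theorems.NewtonUnitEquationsDissociatedUniformTotalsLawIntervalUnion
import Summits.ValiantsHypothesis.ValiantsHypothesis.Theorems.NewtonUnitEquationsDissociatedUniformTotalsLawIntervalUnionLog
import Summits.ValiantsHypothesis.ValiantsHypothesis.Theorems.NewtonUnitEquationsDissociatedUniformTotalsLawStaircase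
import Literature.Computability.AlgebraicComplexity.NewtonPolygonTauProductBounds
import HarnessLib

/-!
# Crux `NewtonUnitEquations.DissociatedUniform` (stmt-ValiantsHypothesis-5905), `n = 3` totals law of model (Q**):
# THE INTERVAL UNION BOUND FOR ARBITRARY PAIRS, LOG-FREE — `IntervalUnionVertBound 24` holds

The located rung `IntervalUnionVertBound C` of `…TotalsLawIntervalUnion` (for all `a b : ℤ/q → ℝ²`, every cyclic window
`Z = [t, t+m)` and every class `s`, `#vert conv ⋃_{z ∈ Z} P_{s-z} ≤ C·q`; `3 ≤ C` necessary, census value `5`; proved up to a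
factor `log₂ q` in `…TotalsLawIntervalUnionLog`) is PROVED here with `C = 24`:
* `unionVert_cycInterval_le : unionVert a b (cycInterval q t m) s ≤ 24·q` (pointwise, every class, arbitrary curves);
* `intervalUnionVertBound_holds : IntervalUnionVertBound 24`;
* `unionTotal_cycInterval_le : unionTotal a b (cycInterval q t m) ≤ 24·q²`;
* `classVert_le_of_interval_levels_linear` / `totalVert_le_of_interval_levels_linear`: if every level set of the third curve `c` is
  a cyclic interval and `c` takes `≤ k` values, then `V_s ≤ 24·k·q` for EVERY class and `T(a,b,c) ≤ 24·k·q²` — the `n = 3` law,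
  pointwise and in total, on the interval-valued-third-curve stratum with an ARBITRARY pair (a general pointwise class bound is false,
  `…TotalsLawParabolaGadget`; the refuted unrestricted union rung `UnionVertBound` is `Θ(q^{4/3})` pointwise, `…TotalsLawUnionVertOrder`);
  unions of `r` windows, few-run third curves and automorphic images follow in `…TotalsLawIntervalUnionLinearRuns`.

Mechanism.  `U_s([t,t+m)) = ⋃_x (a x + b[σ_x, σ_x + m))` is a union of translated WINDOWS OF ONE LENGTH of the periodic point sequence
`n ↦ b n` (`…IntervalUnionLog.unionPts_cycInterval_eq`).  Cut every window at the block boundary of the blocks `[tm, (t+1)m)`: the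
parts inside block `t` of the windows STARTING in block `t` form a STAIRCASE (half-graph) restricted sum — translate `x`, keyed by
`σ_x mod m`, meets exactly the block points at keys `≥` its own (`winSuf`) — and their parts inside block `t + 1` form another
(`winPre`, keys `<`); `windows_eq_biUnion`.  By the staircase hull bound (`…TotalsLawStaircase.Stair.ncard_extremePoints_stairPts_le`:
`≤ 4·(#rows + #columns)`), block `t` costs `≤ 8·(#{x : ⌊σ_x/m⌋ = t} + m)`, in total `≤ 8q + 8m(q/m + 1) ≤ 24q`
(`ncard_extremePoints_windows_le_linear`).  Honest label: a stratum theorem (interval position sets / interval-valued third curves,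
arbitrary pairs); `UnionTotalsLaw C`, `TriWordsBound C`, `TotalsLawThree C` remain OPEN and are asserted nowhere; nothing here bears
on VP ≠ VNP. [folklore]
-/

set_option linter.dupNamespace false -- `ValiantsHypothesis.ValiantsHypothesis` (summit = problem) in every name

open Finset
open scoped Pointwise

namespace Summit.ValiantsHypothesis.ValiantsHypothesis.Theorems.NewtonUnitEquationsDissociatedUniform

namespace TotalsLaw

open Literature.Computability.AlgebraicComplexity.KPTT.PlanarMinkowski

/-! ### Windows of one length: the block decomposition into staircases -/

section Windows

variable {ι : Type*} [Fintype ι]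

/-- Row positions for the block decomposition: `e i + M·(l i mod m)` with `e` an enumeration of `ι` and `M = 2|ι| + 2`. -/
noncomputable def winRowPos (l : ι → ℕ) (m : ℕ) (i : ι) : ℕ :=
  (Fintype.equivFin ι i : ℕ) + (2 * Fintype.card ι + 2) * (l i % m)

/-- Column positions for the block decomposition: `(|ι| + 1) + M·c`. -/
def winColPos (ι : Type*) [Fintype ι] (c : ℕ) : ℕ := (Fintype.card ι + 1) + (2 * Fintype.card ι + 2) * c

omit [Fintype ι] in
/-- Comparison of mixed-radix codes, I. [folklore] -/
private theorem code_lt_iff {E e r c : ℕ} (he : e < E + 1) :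
    e + (2 * E + 2) * r < (E + 1) + (2 * E + 2) * c ↔ r ≤ c := by
  constructor
  · intro h
    by_contra hc
    have h1 : (2 * E + 2) * (c + 1) ≤ (2 * E + 2) * r := Nat.mul_le_mul_left _ (by omega)
    rw [mul_add, mul_one] at h1
    omega
  · intro h
    have h1 : (2 * E + 2) * r ≤ (2 * E + 2) * c := Nat.mul_le_mul_left _ h
    omega

omit [Fintype ι] in
/-- Comparison of mixed-radix codes, II. [folklore] -/
private theorem code_lt_iff' {E e r c : ℕ} (he : e < E + 1) :
    (E + 1) + (2 * E + 2) * c < e + (2 * E + 2) * r ↔ c < r := by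
  constructor
  · intro h
    by_contra hc
    have h1 : (2 * E + 2) * r ≤ (2 * E + 2) * c := Nat.mul_le_mul_left _ (by omega)
    omega
  · intro h
    have h1 : (2 * E + 2) * (c + 1) ≤ (2 * E + 2) * r := Nat.mul_le_mul_left _ (by omega)
    rw [mul_add, mul_one] at h1
    omega

/-- `winRowPos i < winColPos c ↔ l i mod m ≤ c`. [folklore] -/
theorem winRowPos_lt_winColPos_iff (l : ι → ℕ) (m : ℕ) (i : ι) (c : ℕ) :
    winRowPos l m i < winColPos ι c ↔ l i % m ≤ c :=
  code_lt_iff (by have := (Fintype.equivFin ι i).isLt; omega)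

/-- `winColPos c < winRowPos i ↔ c < l i mod m`. [folklore] -/
theorem winColPos_lt_winRowPos_iff (l : ι → ℕ) (m : ℕ) (i : ι) (c : ℕ) :
    winColPos ι c < winRowPos l m i ↔ c < l i % m :=
  code_lt_iff' (by have := (Fintype.equivFin ι i).isLt; omega)

/-- Row positions are injective. [folklore] -/
theorem winRowPos_injective (l : ι → ℕ) (m : ℕ) : Function.Injective (winRowPos l m) := by
  intro i i' h
  unfold winRowPos at h
  have hM : 0 < 2 * Fintype.card ι + 2 := by omega
  have hi := (Fintype.equivFin ι i).isLt
  have hi' := (Fintype.equivFin ι i').isLt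
  have h1 : (Fintype.equivFin ι i : ℕ) = (Fintype.equivFin ι i' : ℕ) := by
    have := congrArg (· % (2 * Fintype.card ι + 2)) h
    simp only [Nat.add_mul_mod_self_left] at this
    rwa [Nat.mod_eq_of_lt (by omega : (Fintype.equivFin ι i : ℕ) < 2 * Fintype.card ι + 2),
      Nat.mod_eq_of_lt (by omega : (Fintype.equivFin ι i' : ℕ) < 2 * Fintype.card ι + 2)] at this
  exact (Fintype.equivFin ι).injective (Fin.ext h1)

/-- Column positions are injective. [folklore] -/
theorem winColPos_injective (ι : Type*) [Fintype ι] : Function.Injective (winColPos ι) := by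
  intro c c' h
  unfold winColPos at h
  have := Nat.eq_of_mul_eq_mul_left (show 0 < 2 * Fintype.card ι + 2 by omega) (by omega : (2 * Fintype.card ι + 2) * c = (2 * Fintype.card ι + 2) * c')
  exact this

/-- The rows (translates) whose window starts in block `t`. -/
noncomputable def winRows (l : ι → ℕ) (m t : ℕ) : Finset ι := Finset.univ.filter fun i => l i / m = t

/-- The SUFFIX staircase of block `t`: the parts `[l i, (t+1)m)` of the windows starting in block `t`. -/
noncomputable def winSuf (b : ℕ → (Fin 2 → ℝ)) (v : ι → (Fin 2 → ℝ)) (l : ι → ℕ) (m t : ℕ) : Finset (Fin 2 → ℝ) :=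
  Stair.stairPts (winRows l m t) (Finset.range m) (winRowPos l m) (winColPos ι) v fun c => b (t * m + c)

/-- The PREFIX staircase of block `t + 1`: the parts `[(t+1)m, l i + m)` of the windows starting in block `t`. -/
noncomputable def winPre (b : ℕ → (Fin 2 → ℝ)) (v : ι → (Fin 2 → ℝ)) (l : ι → ℕ) (m t : ℕ) : Finset (Fin 2 → ℝ) :=
  Stair.stairPts (Finset.range m) (winRows l m t) (winColPos ι) (winRowPos l m) (fun c => b ((t + 1) * m + c)) v

/-- **Block decomposition.** A union of translated windows OF ONE LENGTH `m` of a point sequence, with starts `< N`, is the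
union over the blocks `t ≤ N / m` of a suffix staircase and a prefix staircase. [folklore] -/
theorem windows_eq_biUnion (b : ℕ → (Fin 2 → ℝ)) (v : ι → (Fin 2 → ℝ)) (l : ι → ℕ) (m N : ℕ) (hl : ∀ i, l i < N) :
    (⋃ i, (v i +ᵥ (b '' Set.Ico (l i) (l i + m)))) =
      (((Finset.range (N / m + 1)).biUnion fun t => winSuf b v l m t ∪ winPre b v l m t : Finset (Fin 2 → ℝ)) :
        Set (Fin 2 → ℝ)) := by
  classical
  ext y
  simp only [Set.mem_iUnion, Finset.coe_biUnion, Finset.mem_coe, Finset.mem_union]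
  constructor
  · rintro ⟨i, hy⟩
    rw [Set.mem_vadd_set] at hy
    obtain ⟨z, ⟨n, ⟨hn1, hn2⟩, rfl⟩, rfl⟩ := hy
    have hm : 0 < m := by omega
    set t := l i / m with ht
    have hdiv : t * m + l i % m = l i := by rw [ht]; exact Nat.div_add_mod' (l i) m
    have hr : l i % m < m := Nat.mod_lt _ hm
    refine ⟨t, Finset.mem_range.2 (Nat.lt_succ_of_le (Nat.div_le_div_right (hl i).le)), ?_⟩
    have hrow : i ∈ winRows l m t := Finset.mem_filter.2 ⟨Finset.mem_univ _, rfl⟩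
    by_cases hnt : n < t * m + m
    · -- suffix part of block `t`
      left
      refine Stair.mem_stairPts.2 ⟨i, hrow, n - t * m, Finset.mem_range.2 (by omega), ?_, ?_⟩
      · rw [winRowPos_lt_winColPos_iff]; omega
      · show v i + b (t * m + (n - t * m)) = v i +ᵥ b n
        rw [vadd_eq_add]; congr 2; omega
    · -- prefix part of block `t + 1`
      right
      push Not at hnt
      refine Stair.mem_stairPts.2 ⟨n - (t * m + m), Finset.mem_range.2 (by omega), i, hrow, ?_, ?_⟩
      · rw [winColPos_lt_winRowPos_iff]; omega
      · show b ((t + 1) * m + (n - (t * m + m))) + v i = v i +ᵥ b n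
        rw [vadd_eq_add, add_comm (b _) (v i)]; congr 2; rw [add_mul, one_mul]; omega
  · rintro ⟨t, -, h | h⟩
    · obtain ⟨i, hi, c, hc, hlt, rfl⟩ := Stair.mem_stairPts.1 h
      rw [winRowPos_lt_winColPos_iff] at hlt
      obtain ⟨-, hit⟩ := Finset.mem_filter.1 hi
      have hc' := Finset.mem_range.1 hc
      have hm : 0 < m := by omega
      have hdiv : t * m + l i % m = l i := by rw [← hit]; exact Nat.div_add_mod' (l i) m
      have hr : l i % m < m := Nat.mod_lt _ hm
      refine ⟨i, ?_⟩
      rw [Set.mem_vadd_set]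
      exact ⟨b (t * m + c), ⟨t * m + c, ⟨by omega, by omega⟩, rfl⟩, vadd_eq_add _ _⟩
    · obtain ⟨c, hc, i, hi, hlt, rfl⟩ := Stair.mem_stairPts.1 h
      rw [winColPos_lt_winRowPos_iff] at hlt
      obtain ⟨-, hit⟩ := Finset.mem_filter.1 hi
      have hc' := Finset.mem_range.1 hc
      have hm : 0 < m := by omega
      have hdiv : t * m + l i % m = l i := by rw [← hit]; exact Nat.div_add_mod' (l i) m
      have hr : l i % m < m := Nat.mod_lt _ hm
      refine ⟨i, ?_⟩
      rw [Set.mem_vadd_set]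
      refine ⟨b ((t + 1) * m + c), ⟨(t + 1) * m + c, ⟨?_, ?_⟩, rfl⟩, ?_⟩
      · rw [add_mul, one_mul]; omega
      · rw [add_mul, one_mul]; omega
      · show v i +ᵥ b ((t + 1) * m + c) = b ((t + 1) * m + c) + v i
        rw [vadd_eq_add, add_comm]

/-- `#vert conv (S ∪ P) ≤ #vert conv S + #vert conv P` for finite planar sets. [folklore] -/
private theorem ncard_extremePoints_union_le (S P : Finset (Fin 2 → ℝ)) :
    ((convexHull ℝ ((S ∪ P : Finset (Fin 2 → ℝ)) : Set (Fin 2 → ℝ))).extremePoints ℝ).ncard ≤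
      ((convexHull ℝ (S : Set (Fin 2 → ℝ))).extremePoints ℝ).ncard +
        ((convexHull ℝ (P : Set (Fin 2 → ℝ))).extremePoints ℝ).ncard := by
  classical
  have h := ncard_extremePoints_biUnion_le ({0, 1} : Finset ℕ) (fun k => if k = 0 then S else P)
  have h1 : (({0, 1} : Finset ℕ).biUnion fun k => if k = 0 then S else P) = S ∪ P := by
    rw [Finset.biUnion_insert, Finset.singleton_biUnion, if_pos rfl, if_neg Nat.one_ne_zero]
  rw [h1, Finset.sum_insert (by simp), Finset.sum_singleton, if_pos rfl, if_neg Nat.one_ne_zero] at h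
  exact h

/-- **Unions of translated windows of one length, LINEAR bound:** for a point sequence `b : ℕ → ℝ²`, translations `v i` and
windows `[l i, l i + m)` with `l i < N` (`i : ι`), `#vert conv ⋃ i (v i + b[l i, l i + m)) ≤ 8·|ι| + 8·m·(N/m + 1)`.
(The dyadic bound of `…TotalsLawIntervalUnionLog.ncard_extremePoints_windows_le` carried a factor `log`.) [folklore] -/
theorem ncard_extremePoints_windows_le_linear (b : ℕ → (Fin 2 → ℝ)) (v : ι → (Fin 2 → ℝ)) (l : ι → ℕ) (m N : ℕ)
    (hl : ∀ i, l i < N) :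
    (Set.extremePoints ℝ (convexHull ℝ (⋃ i, (v i +ᵥ (b '' Set.Ico (l i) (l i + m)))))).ncard ≤
      8 * Fintype.card ι + 8 * m * (N / m + 1) := by
  classical
  rw [windows_eq_biUnion b v l m N hl]
  refine (ncard_extremePoints_biUnion_le _ _).trans ?_
  have hpiece : ∀ t ∈ Finset.range (N / m + 1),
      ((convexHull ℝ ((winSuf b v l m t ∪ winPre b v l m t : Finset (Fin 2 → ℝ)) : Set (Fin 2 → ℝ))).extremePoints
          ℝ).ncard ≤ 8 * (winRows l m t).card + 8 * m := by
    intro t _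
    have hS : ((convexHull ℝ (winSuf b v l m t : Set (Fin 2 → ℝ))).extremePoints ℝ).ncard ≤
        4 * ((winRows l m t).card + m) := by
      have h := Stair.ncard_extremePoints_stairPts_le (R := winRows l m t) (C := Finset.range m) (v := v)
        (b := fun c => b (t * m + c)) (winRowPos_injective l m) (winColPos_injective ι)
      rw [Finset.card_range] at h
      exact h
    have hP : ((convexHull ℝ (winPre b v l m t : Set (Fin 2 → ℝ))).extremePoints ℝ).ncard ≤
        4 * (m + (winRows l m t).card) := by
      have h := Stair.ncard_extremePoints_stairPts_le (R := Finset.range m) (C := winRows l m t)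
        (v := fun c => b ((t + 1) * m + c)) (b := v) (winColPos_injective ι) (winRowPos_injective l m)
      rw [Finset.card_range] at h
      exact h
    have hU := ncard_extremePoints_union_le (winSuf b v l m t) (winPre b v l m t)
    omega
  refine (Finset.sum_le_sum hpiece).trans ?_
  rw [Finset.sum_add_distrib, Finset.sum_const, Finset.card_range, smul_eq_mul, ← Finset.mul_sum,
    mul_comm (N / m + 1) (8 * m)]
  have hrows : ∑ t ∈ Finset.range (N / m + 1), (winRows l m t).card ≤ Fintype.card ι := by
    rw [← Finset.card_univ, Finset.card_eq_sum_card_fiberwise (s := Finset.univ) (t := Finset.range (N / m + 1))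
      (f := fun i => l i / m) (fun i _ => Finset.mem_coe.2 (Finset.mem_range.2
        (Nat.lt_succ_of_le (Nat.div_le_div_right (hl i).le))))]
    unfold winRows
    exact le_rfl
  have := Nat.mul_le_mul_left 8 hrows
  omega

end Windows

/-! ### The interval union bound, log-free -/

section Cyclic

variable {q : ℕ} [NeZero q]

/-- **THE INTERVAL UNION BOUND, pointwise, for ARBITRARY pairs:** `#vert conv U_s([t, t+m)) ≤ 24·q` for all
`a b : ℤ/q → ℝ²`, every cyclic window `[t, t+m)` and every class `s`. -/
theorem unionVert_cycInterval_le (a b : ZMod q → (Fin 2 → ℝ)) (t m : ℕ) (s : ZMod q) :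
    unionVert a b (cycInterval q t m : Set (ZMod q)) s ≤ 24 * q := by
  -- reduce to windows of length `≤ q`
  wlog hm : m ≤ q generalizing m
  · have h := this q le_rfl
    rwa [cycInterval_eq_univ_of_le t le_rfl, ← cycInterval_eq_univ_of_le t (le_of_not_ge hm)] at h
  unfold unionVert; rw [unionPts_cycInterval_eq]
  have hmain := ncard_extremePoints_windows_le_linear (fun n : ℕ => b (n : ZMod q)) a (winStart t m s) m q
    (fun x => winStart_lt t m s x)
  rw [ZMod.card] at hmain
  have h1 : m * (q / m) ≤ q := Nat.mul_div_le q m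
  have h2 : 8 * m * (q / m + 1) = 8 * (m * (q / m)) + 8 * m := by ring
  omega

/-- **`IntervalUnionVertBound 24` HOLDS** — the located rung of `…TotalsLawIntervalUnion` (`3 ≤ C` necessary, census value `5`),
previously known up to a factor `log₂ q` (`…TotalsLawIntervalUnionLog`). -/
theorem intervalUnionVertBound_holds : IntervalUnionVertBound 24 :=
  fun _q _ a b t m s => unionVert_cycInterval_le a b t m s

/-- Every `C ≥ 24` is a valid constant of the interval rung (and `C ≤ 2` is not, `not_intervalUnionVertBound_two`). -/
theorem intervalUnionVertBound_of_ge {C : ℕ} (hC : 24 ≤ C) : IntervalUnionVertBound C :=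
  intervalUnionVertBound_mono hC intervalUnionVertBound_holds

/-- **The interval union TOTALS:** `∑_s #vert conv U_s([t,t+m)) ≤ 24·q²` for all `a, b`. -/
theorem unionTotal_cycInterval_le (a b : ZMod q → (Fin 2 → ℝ)) (t m : ℕ) :
    unionTotal a b (cycInterval q t m : Set (ZMod q)) ≤ 24 * q ^ 2 := by
  unfold unionTotal
  calc ∑ s, unionVert a b (cycInterval q t m : Set (ZMod q)) s ≤ ∑ _s : ZMod q, 24 * q :=
        Finset.sum_le_sum fun s _ => unionVert_cycInterval_le a b t m s
    _ = 24 * q ^ 2 := by rw [Finset.sum_const, Finset.card_univ, ZMod.card, smul_eq_mul]; ring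

/-- **The `n = 3` law for an interval-valued third curve, POINTWISE, log-free:** if every level set of `c` is a cyclic
interval and `c` takes at most `k` values, then `V_s ≤ 24·k·q` for every class `s` — with `a, b` ARBITRARY. -/
theorem classVert_le_of_interval_levels_linear (a b c : ZMod q → (Fin 2 → ℝ)) [DecidableEq (Fin 2 → ℝ)]
    (hc : ∀ v, ∃ t m, c ⁻¹' {v} = (cycInterval q t m : Set (ZMod q))) {k : ℕ}
    (hk : (Finset.univ.image c).card ≤ k) (s : ZMod q) :
    classVert a b c s ≤ 24 * k * q := by
  calc classVert a b c s ≤ ∑ v ∈ Finset.univ.image c, unionVert a b (c ⁻¹' {v}) s :=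
        classVert_le_sum_unionVert a b c s
    _ ≤ ∑ _v ∈ Finset.univ.image c, 24 * q :=
        Finset.sum_le_sum fun v _ => by
          obtain ⟨t, m, h⟩ := hc v
          rw [h]
          exact unionVert_cycInterval_le a b t m s
    _ ≤ 24 * k * q := by
        rw [Finset.sum_const, smul_eq_mul]
        calc (Finset.univ.image c).card * (24 * q) ≤ k * (24 * q) := Nat.mul_le_mul_right _ hk
          _ = 24 * k * q := by ring

/-- **… and in TOTAL:** `T(a, b, c) ≤ 24·k·q²` for `a, b` arbitrary and `c` taking `≤ k` values on cyclic-interval level sets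
(the indicator of an interval: `k = 2`, `T ≤ 48 q²`). -/
theorem totalVert_le_of_interval_levels_linear (a b c : ZMod q → (Fin 2 → ℝ)) [DecidableEq (Fin 2 → ℝ)]
    (hc : ∀ v, ∃ t m, c ⁻¹' {v} = (cycInterval q t m : Set (ZMod q))) {k : ℕ}
    (hk : (Finset.univ.image c).card ≤ k) :
    totalVert a b c ≤ 24 * k * q ^ 2 := by
  unfold totalVert
  calc ∑ s, classVert a b c s ≤ ∑ _s : ZMod q, 24 * k * q :=
        Finset.sum_le_sum fun s _ => classVert_le_of_interval_levels_linear a b c hc hk s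
    _ = 24 * k * q ^ 2 := by rw [Finset.sum_const, Finset.card_univ, ZMod.card, smul_eq_mul]; ring

end Cyclic

end TotalsLaw

end Summit.ValiantsHypothesis.ValiantsHypothesis.Theorems.NewtonUnitEquationsDissociatedUniform
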